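import Summits.BirchSwinnertonDyer.Rank1Residual.P2.KrizLiTwoFortyThreeSlices
import Literature.NumberTheory.EllipticCurves.LeadingTermBSZOrdinaryProofs
import Literature.NumberTheory.EllipticCurves.HasseElementary
import Mathlib.Tactic.NormNum.LegendreSymbol
import HarnessLib

/-!
# Cell `bsd-print-cf2` (D-0131 (2) PRINT TIER, leaf CornerF @ `p = 2`), prover p3 — the Kriz–Li index
# set `𝒮` of `(243a1, ℚ(√−23))` made DECIDABLE: `a_ℓ(243a1)` is odd iff `x³ = 48` has an even number
# of roots in `𝔽_ℓ`; explicit members `ℓ = 13, 31, 73` and the twists `243a1^{(13)}`, `243a1^{(−299)}`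

HONEST FRAMING. Companion of `P2/KrizLiTwoFortyThree{Curve,Slices,IsogenyClass}.lean`. Kriz–Li's set
`𝒮 = {ℓ ∤ 2N : ℓ split in K, Frob_ℓ of order 3 on E[2]}` (Def 4.1), typed by the tree as
`KrizLi2019.InS` with "order `3`" read as "`a_ℓ(E)` odd", enters the membership predicate
`P2.IsKrizLiTwoFortyThreeTwist` through `P2.IsKrizLiPrime243 ℓ` = (`ℓ` prime, `ℓ ∉ {2,3}`,
`(−23/ℓ) = 1`, `Odd (a_ℓ(243a1))`). The last conjunct refers to the tree's `frobeniusTrace`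
(`p + 1 − #Ẽ(𝔽_p)` on the abstract integral model), which `decide` cannot evaluate. This file proves,
IN THE KERNEL, the parity criterion `Odd (a_ℓ(243a1)) ⟺ #{x ∈ 𝔽_ℓ : x³ = 48} even` for primes
`ℓ ∉ {2,3}` (the model `y² = x³ − 48` of `243a1`; the involution `y ↦ −y` on the affine points), so that
membership of any given `d` is decided by `decide`/`norm_num`; and records the first members
(`13, 31, 73 ∈ 𝒮`; hence `BSD(W,2)` for every globally minimal model of `243a1^{(13)} : y² = x³ − 48·13³`
and of `243a1^{(−23·13)}`, granted the six named facts of the slice). Nothing is asserted; no named fact;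
beyond print: NO (bookkeeping for certificates; Kriz–Li Example 6.2's own reading "`a_ℓ ≡ 1 (mod 2)`").

References: [KrizLi2019] Def 4.1 (FMS) = arXiv Def 3.1 and p. 14 L57–58 ("its trace `a_ℓ(E) ≡ 1 (mod 2)`");
[SilvermanAEC2009] V.1 (counting points: `#E(𝔽_q) = 1 + Σ_x #{y}`), Exercise 8.19(a); evidence job
j282198 (`𝒮 = {13, 31, 73, 127, 151, 193, …}` = {`ℓ ≡ 1 (3)`, `(−23/ℓ) = 1`, `6` non-cube mod `ℓ`}).
-/

noncomputable section

open WeierstrassCurve NumberField Literature.NumberTheory.EllipticCurves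
  Literature.NumberTheory.EllipticCurves.Rank1Residual
  Summit.BirchSwinnertonDyer.Rank1Residual

set_option autoImplicit false

namespace Summit.BirchSwinnertonDyer.Rank1Residual.P2

/-! ## §11 `243a1 ≅ y² = x³ − 48` and `a_ℓ(243a1)` on that model -/

/-- **`243a1` is `ℚ`-isomorphic to the short model `y² = x³ − 48`** (`x ↦ x/4`, `y ↦ y/8 − 1/2`:
`(8y + 4)² = (4x)³ − 48`). [cite: Cremona1997, Table 1 (curve 243a1)] -/
theorem smul_curve243a1_eq_short :
    (⟨⟨(2 : ℚ)⁻¹, 2, by norm_num, by norm_num⟩, 0, 0, -2⁻¹⟩ : VariableChange ℚ) • curve243a1 =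
      shortWeierstrass (0, -48) := by
  ext <;> simp only [curve243a1, shortWeierstrass, variableChange_a₁, variableChange_a₂, variableChange_a₃,
    variableChange_a₄, variableChange_a₆] <;> push_cast <;> norm_num

/-- `Δ(y² = x³ − 48) = −2¹²·3⁵` on the `ℤ`-model, so a prime `ℓ ∉ {2,3}` does not divide it. [folklore] -/
theorem not_dvd_Δ_short243 {ℓ : ℕ} (hℓ : ℓ.Prime) (h2 : ℓ ≠ 2) (h3 : ℓ ≠ 3) :
    ¬ (ℓ : ℤ) ∣ (⟨0, 0, 0, ((0, -48) : ℤ × ℤ).1, ((0, -48) : ℤ × ℤ).2⟩ : WeierstrassCurve ℤ).Δ := by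
  have hΔ : (⟨0, 0, 0, ((0, -48) : ℤ × ℤ).1, ((0, -48) : ℤ × ℤ).2⟩ : WeierstrassCurve ℤ).Δ =
      -(2 ^ 12 * 3 ^ 5) := by
    simp only [WeierstrassCurve.Δ, WeierstrassCurve.b₂, WeierstrassCurve.b₄, WeierstrassCurve.b₆,
      WeierstrassCurve.b₈]
    norm_num
  rw [hΔ, dvd_neg]
  intro h
  have h' : ℓ ∣ 2 ^ 12 * 3 ^ 5 := by exact_mod_cast h
  rcases (Nat.Prime.dvd_mul hℓ).mp h' with h | h
  · exact h2 ((Nat.prime_dvd_prime_iff_eq hℓ Nat.prime_two).mp (hℓ.dvd_of_dvd_pow h))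
  · exact h3 ((Nat.prime_dvd_prime_iff_eq hℓ Nat.prime_three).mp (hℓ.dvd_of_dvd_pow h))

/-- **`a_ℓ(243a1) = a_ℓ` of the `ℤ`-model `y² = x³ − 48`** for primes `ℓ ∉ {2,3}` (isomorphic over `ℚ`,
both minimal at `ℓ`; tree `frobeniusTrace_eq_of_smul_eq_shortWeierstrass`).
[cite: SilvermanAEC2009, Exercise 8.19(a) with VII.1 Prop. 1.3(b)] -/
theorem frobeniusTrace_curve243a1_eq {ℓ : ℕ} (hℓ : ℓ.Prime) (h2 : ℓ ≠ 2) (h3 : ℓ ≠ 3) :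
    curve243a1.frobeniusTrace ℓ =
      Literature.NumberTheory.Automorphic.frobeniusTrace ⟨0, 0, 0, 0, -48⟩ ℓ := by
  haveI : Fact ℓ.Prime := ⟨hℓ⟩
  exact BSZLemma17.frobeniusTrace_eq_of_smul_eq_shortWeierstrass smul_curve243a1_eq_short ℓ
    (not_dvd_Δ_short243 hℓ h2 h3)

/-! ## §12 The parity of `#Ẽ(𝔽_ℓ)` on a Mordell curve: the involution `y ↦ −y` -/

/-- **Parity of the point count of `y² = x³ + B` over a finite field of odd characteristic**:
`#E(F) ≡ 1 + #{x : x³ + B = 0} (mod 2)` — for each `x` the number of `y` with `y² = x³ + B` is `1` if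
`x³ + B = 0` and `0` or `2` otherwise. [cite: SilvermanAEC2009, V.1 (proof of Thm. 1.1: #E = 1 + Σ_x (1 + χ(x³+Ax+B)))] -/
theorem natCard_point_mod_two_of_shortNF {F : Type*} [Field F] [Fintype F] [DecidableEq F]
    (E : WeierstrassCurve F) [E.IsShortNF] [E.IsElliptic] (hF : ringChar F ≠ 2) (h4 : E.a₄ = 0) :
    Nat.card E.toAffine.Point % 2 =
      (1 + (Finset.univ.filter fun x : F => x ^ 3 + E.a₆ = 0).card) % 2 := by
  rw [HasseElementary.natCard_point_eq E, Nat.add_mod, Finset.sum_nat_mod, Finset.card_filter]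
  conv_rhs => rw [Nat.add_mod, Finset.sum_nat_mod]
  congr 3
  refine Finset.sum_congr rfl fun j _ => ?_
  have hcubic : (HasseElementary.cubic E).eval j = j ^ 3 + E.a₆ := by
    rw [HasseElementary.eval_cubic, h4, zero_mul, add_zero]
  by_cases h0 : j ^ 3 + E.a₆ = 0
  · rw [if_pos h0, HasseElementary.numY_of_eval_eq_zero E hF (by rw [hcubic, h0])]
  · rw [if_neg h0]
    by_cases hs : IsSquare ((HasseElementary.cubic E).eval j)
    · rw [HasseElementary.numY_of_isSquare E hF (by rw [hcubic]; exact h0) hs]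
    · rw [HasseElementary.numY_of_not_isSquare E hF hs]

/-- **`a_ℓ` of the `ℤ`-model `y² = x³ + B` is odd iff `x³ = −B` has an even number of roots mod `ℓ`**
(`ℓ` an odd prime not dividing `Δ`). [cite: SilvermanAEC2009, V.1 and V.2 (a_p = p + 1 − #E(𝔽_p))] -/
theorem odd_frobeniusTrace_mordell_iff {ℓ : ℕ} [NeZero ℓ] (hℓ : ℓ.Prime) (h2 : ℓ ≠ 2) {B : ℤ}
    (hΔ : ¬ (ℓ : ℤ) ∣ (⟨0, 0, 0, 0, B⟩ : WeierstrassCurve ℤ).Δ) :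
    Odd (Literature.NumberTheory.Automorphic.frobeniusTrace ⟨0, 0, 0, 0, B⟩ ℓ) ↔
      Even ((Finset.univ.filter fun x : ZMod ℓ => x ^ 3 = -(B : ZMod ℓ)).card) := by
  haveI : Fact ℓ.Prime := ⟨hℓ⟩
  set E : WeierstrassCurve (ZMod ℓ) := (⟨0, 0, 0, 0, B⟩ : WeierstrassCurve ℤ).map (Int.castRingHom (ZMod ℓ))
    with hE
  haveI : E.IsShortNF := ⟨by simp [hE, WeierstrassCurve.map], by simp [hE, WeierstrassCurve.map],
    by simp [hE, WeierstrassCurve.map]⟩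
  haveI : E.IsElliptic := by
    rw [isElliptic_iff, hE, map_Δ, isUnit_iff_ne_zero, eq_intCast, Ne, ZMod.intCast_zmod_eq_zero_iff_dvd]
    exact hΔ
  have hchar : ringChar (ZMod ℓ) ≠ 2 := by rw [ZMod.ringChar_zmod_n]; exact h2
  have h4 : E.a₄ = 0 := by simp [hE, WeierstrassCurve.map]
  have h6 : E.a₆ = (B : ZMod ℓ) := by simp [hE, WeierstrassCurve.map]
  have hN : Nat.card E.toAffine.Point % 2 =
      (1 + (Finset.univ.filter fun x : ZMod ℓ => x ^ 3 = -(B : ZMod ℓ)).card) % 2 := by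
    rw [natCard_point_mod_two_of_shortNF E hchar h4]
    congr 3
    ext x
    simp only [Finset.mem_filter, Finset.mem_univ, true_and, h6]
    exact add_eq_zero_iff_eq_neg
  have hodd : ℓ % 2 = 1 := Nat.odd_iff.mp (hℓ.odd_of_ne_two h2)
  have hgoal : Literature.NumberTheory.Automorphic.frobeniusTrace ⟨0, 0, 0, 0, B⟩ ℓ =
      (ℓ : ℤ) + 1 - (Nat.card E.toAffine.Point : ℤ) := rfl
  rw [hgoal, Int.odd_iff, Nat.even_iff]
  omega

/-- **`a_ℓ(243a1)` is odd iff `x³ = 48` has an even number of solutions in `𝔽_ℓ`** (`ℓ ∉ {2,3}` prime)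
— the decidable form of the last clause of `IsKrizLiPrime243`. (For `ℓ ≡ 2 (mod 3)` there is exactly
one cube root, so `a_ℓ` is even — indeed `0`; for `ℓ ≡ 1 (mod 3)` there are `0` or `3`, so `a_ℓ` is odd
iff `48`, equivalently `6`, is a non-cube mod `ℓ`.)
[cite: KrizLi2019, Def. 4.1 and p. 14 L57–58 (arXiv:1606.03172) ("a_ℓ(E) ≡ 1 (mod 2)")] -/
theorem odd_frobeniusTrace_curve243a1_iff {ℓ : ℕ} [NeZero ℓ] (hℓ : ℓ.Prime) (h2 : ℓ ≠ 2) (h3 : ℓ ≠ 3) :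
    Odd (curve243a1.frobeniusTrace ℓ) ↔
      Even ((Finset.univ.filter fun x : ZMod ℓ => x ^ 3 = 48).card) := by
  rw [frobeniusTrace_curve243a1_eq hℓ h2 h3, odd_frobeniusTrace_mordell_iff hℓ h2
    (by simpa using not_dvd_Δ_short243 hℓ h2 h3)]
  have h48 : (-((-48 : ℤ) : ZMod ℓ)) = 48 := by push_cast; ring
  rw [h48]

/-- **Decidable form of `ℓ ∈ 𝒮`** for `(243a1, ℚ(√−23))`: `IsKrizLiPrime243 ℓ` iff `ℓ` is a prime
`∉ {2,3}` with `(−23/ℓ) = 1` and an even number of cube roots of `48` in `𝔽_ℓ`.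
[cite: KrizLi2019, Def. 4.1 (FMS) = arXiv Def. 3.1] -/
theorem isKrizLiPrime243_iff {ℓ : ℕ} [NeZero ℓ] :
    IsKrizLiPrime243 ℓ ↔ ℓ.Prime ∧ ℓ ≠ 2 ∧ ℓ ≠ 3 ∧ jacobiSym (-23) ℓ = 1 ∧
      Even ((Finset.univ.filter fun x : ZMod ℓ => x ^ 3 = 48).card) := by
  constructor
  · rintro ⟨hℓ, h2, h3, hj, hodd⟩
    exact ⟨hℓ, h2, h3, hj, (odd_frobeniusTrace_curve243a1_iff hℓ h2 h3).1 hodd⟩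
  · rintro ⟨hℓ, h2, h3, hj, hev⟩
    exact ⟨hℓ, h2, h3, hj, (odd_frobeniusTrace_curve243a1_iff hℓ h2 h3).2 hev⟩

/-! ## §13 The first members of `𝒮` and of the family -/

/-- **`13 ∈ 𝒮`**: `(−23/13) = 1` and `x³ = 48 = 9` has no root in `𝔽₁₃` (cubes are `0, ±1, ±5`).
[cite: KrizLi2019, Def. 4.1] -/
theorem isKrizLiPrime243_thirteen : IsKrizLiPrime243 13 :=
  isKrizLiPrime243_iff.2 ⟨by norm_num, by norm_num, by norm_num, by norm_num, by decide⟩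

/-- **`31 ∈ 𝒮`**. [cite: KrizLi2019, Def. 4.1] -/
theorem isKrizLiPrime243_thirtyOne : IsKrizLiPrime243 31 :=
  isKrizLiPrime243_iff.2 ⟨by norm_num, by norm_num, by norm_num, by norm_num, by decide⟩

/-- **`73 ∈ 𝒮`**. [cite: KrizLi2019, Def. 4.1] -/
theorem isKrizLiPrime243_seventyThree : IsKrizLiPrime243 73 :=
  isKrizLiPrime243_iff.2 ⟨by norm_num, by norm_num, by norm_num, by norm_num, by decide⟩

/-- **`7 ∉ 𝒮`** although `(−23/7) = 1`: `x³ = 48 = 6` has the three roots `3, 5, 6` in `𝔽₇`, so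
`a₇(243a1)` is even (indeed `7 ≡ 1 (mod 3)` and `6` is a cube mod `7`). [cite: KrizLi2019, Def. 4.1] -/
theorem not_isKrizLiPrime243_seven : ¬ IsKrizLiPrime243 7 := by
  intro h
  have h7 := (isKrizLiPrime243_iff.1 h).2.2.2.2
  revert h7
  decide

/-- **`d = 13` is an explicit member**: every `ℚ`-model of `243a1^{(13)} : y² = x³ − 48·13³` or of
`243a1^{(−299)}` is in the Kriz–Li family of `243a1`. [cite: KrizLi2019, Def. 4.1 and Thm. 5.1 (2)] -/
theorem isKrizLiTwoFortyThreeTwist_thirteen {W : WeierstrassCurve ℚ} {C : VariableChange ℚ}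
    (hC : C • curve243a1.quadraticTwist (13 : ℤ) = W ∨
      C • curve243a1.quadraticTwist ((-23 * 13 : ℤ) : ℚ) = W) : IsKrizLiTwoFortyThreeTwist W :=
  isKrizLiTwoFortyThreeTwist_of_explicit (d := 13) (by norm_num) (by decide)
    (by exact (Nat.prime_iff.1 (by norm_num)).squarefree)
    (fun ℓ hℓ hℓd => by
      have h13 : ℓ ∣ 13 := by simpa using hℓd
      obtain rfl := (Nat.prime_dvd_prime_iff_eq hℓ (by norm_num)).mp h13
      exact isKrizLiPrime243_thirteen) hC

/-- **`BSD(W, 2)` for every globally minimal model of `243a1^{(13)}`** (`y² = x³ − 105456` up to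
`ℚ`-isomorphism; analytic rank one) **and of `243a1^{(−299)}`** (analytic rank zero), granted BY NAME
Kriz–Li 2019 Thm 5.1 (2) / Thm 4.3, the Table-1 row `243a1`, Creutz–Miller 2012, Burungale–Flach 2024
and modularity — the membership decided in the kernel. [cite: KrizLi2019, Thm. 5.1 (2), Def. 4.1, Table 1 row 243a1]
[cite: CreutzMiller2012, Thm. 1.1] [cite: BurungaleFlach2024, Cor. 2] -/
theorem bsdp_two_twist_thirteen_curve243a1 (hKL : KrizLi2019.thm112_bsdTwo_twist)
    (h33 : KrizLi2019.thm33_rank_twist) (htab : KrizLi2019.table1_row243a1)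
    (hS31 : bsdTriple_of_analyticRank_le_one_of_conductor_lt) (hBF : bsdTriple_of_hasCM_of_L_one_ne_zero)
    (hmod : hasEntireLFunction_rat) (W : WeierstrassCurve ℚ) [W.IsElliptic] [W.IsGloballyMinimal]
    {C : VariableChange ℚ}
    (hC : C • curve243a1.quadraticTwist (13 : ℤ) = W ∨
      C • curve243a1.quadraticTwist ((-23 * 13 : ℤ) : ℚ) = W) : BSDp W 2 :=
  bsdp_two_of_isKrizLiTwoFortyThreeTwist hKL h33 htab hS31 hBF hmod W (isKrizLiTwoFortyThreeTwist_thirteen hC)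

end Summit.BirchSwinnertonDyer.Rank1Residual.P2

end
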